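import Mathlib
import HarnessLib
import Literature.Probability.LatticeModels.IsingThermodynamics
import Summits.CriticalPhenomena.Ising3DConformalLimit.Theorems.PrecisionLaplacianDirectCorrelationStableTailPointwiseUpgradeAux
import Summits.CriticalPhenomena.Ising3DConformalLimit.Theorems.PrecisionLaplacianDirectCorrelationStableTailPointwiseUpgradeAux2
import Summits.CriticalPhenomena.Ising3DConformalLimit.Theorems.PrecisionLaplacianDirectCorrelationStableTailPointwiseUpgradeAux3

/-!
# Stub `stub_pointwiseUpgrade` of line `self-energy-pick-inversion`
(crux `PrecisionLaplacian.DirectCorrelationStableTail`, item stmt-CriticalPhenomena-4799)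

The final SOFT-ANALYSIS UPGRADE of the line, in honest generality (no Ising input): for
`a : ℤ³ → ℝ` with `a ≥ 0` off the origin, `0 < η < 1`, `c > 0`, assume
* radial asymptotics of the slab sums `S⁽ⁱ⁾(n) n^{3-η} → c`;
* regularity at scale of the profile `h(x) = a(x) |x|₂^{5-η}` ((R1) boundedness, (R2) slow variation
  `|h x - h y| ≤ ε` for `|x|₂ ≥ R₀`, `|x - y|₂ ≤ δ |x|₂`, (R3) slab tightness);
* convergence of the tail functionals `Λ_R(f) = R^{2-η} ∑' a(x) f(x/R)` (`R → ∞` in `ℕ`) for every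
  continuous compactly supported `f` with `0 ∉ tsupport f`.
Then `a` has a STABLE TAIL: there is `Φ`, continuous and nonnegative on the Euclidean unit sphere,
positive somewhere, with `h(x) - Φ(x/|x|₂) → 0` along the cofinite filter (with the same `η`).

Proof (folklore; cf. Meerschaert–Scheffler 2001, ch. 8, for the measure-level notion):
1. (`approx_rounding`) (R2) makes `h` almost constant on `‖y - N u‖∞ ≤ δ' N` around `⌊N u⌋`.
2. (`cauchySeq_profile`) Testing the tail functionals against bumps `f_{u,ρ}` and comparing with
   the lattice Riemann sums `N⁻³ ∑ |y/N|₂^{η-5} f_{u,ρ}(y/N) → ∫ |v|₂^{η-5} f_{u,ρ} > 0` shows that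
   `N ↦ h ⌊N u⌋` is Cauchy; `Φ u := lim_N h ⌊N u⌋`.
3. (`continuousOn_profileLimit`, `profile_uniform`, `tendsto_profile_cofinite`) continuity of `Φ`
   on the sphere, uniformity of the convergence via a finite net of the compact sphere, and the
   cofinite statement with `N = ⌊|x|₂⌋`, `u = x/|x|₂`.
4. (`profileLimit_nonneg`, `false_of_profile_small`) `Φ ≥ 0`; and `Φ ≢ 0`, since `Φ ≡ 0` would
   force `h → 0`, whence by (R3) `S(n) n^{3-η} → 0`, contradicting `c > 0`.
-/

noncomputable section

namespace Summit.CriticalPhenomena.Ising3DConformalLimit.Cruxes.DirectCorrelationStableTail.SelfEnergyPickInversion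

open MeasureTheory Filter Topology
open scoped BigOperators
open Literature.Probability.LatticeModels

/-- **Registered stub `stub_pointwiseUpgrade`** (signature EXACTLY as registered on stmt-CriticalPhenomena-4799; package form:
`∀ (a : Site 3 → ℝ) (η c : ℝ), (∀ x, x ≠ 0 → 0 ≤ a x) → 0 < η → η < 1 → 0 < c → HasRadialAsymptotics a η c → IsRegularAtScale a η → TailMeasuresConverge a η → HasStableTail a`).

Pointwise upgrade: radial asymptotics + regularity at scale + convergence of the tail functionals
imply a stable tail `h(x) - Φ(x/|x|₂) → 0` (cofinite) with `Φ` continuous, `≥ 0` and somewhere `> 0`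
on the unit sphere; `Φ u = lim_N h ⌊N u⌋`.  Proof: rounding lemma from (R2), Cauchy property along
rounded rays from the tail functionals tested against bumps and the lattice Riemann-sum lemma,
uniformity over the compact sphere, non-degeneracy from (R3) and the radial asymptotics.
[folklore; cf. Meerschaert–Scheffler, *Limit Distributions for Sums of Independent Random Vectors*
(2001), ch. 8] -/
theorem stub_pointwiseUpgrade :
    ∀ (a : Site 3 → ℝ) (η c : ℝ), (∀ x : Site 3, x ≠ 0 → 0 ≤ a x) →
    0 < η → η < 1 → 0 < c →
    (∀ i : Fin 3, Filter.Tendsto (fun n : ℕ => (∑' y : Fin 2 → ℤ, a (Fin.insertNth i (n : ℤ) (y) : Site 3))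
      * (n : ℝ) ^ (3 - η)) Filter.atTop (nhds c)) →
    ((∃ C : ℝ, ∀ x : Site 3, x ≠ 0 → a x * Real.sqrt (∑ j, ((x) j : ℝ) ^ 2) ^ (5 - η) ≤ C) ∧ (∀ ε : ℝ, 0 <
      ε → ∃ δ : ℝ, 0 < δ ∧ ∃ R₀ : ℝ, ∀ x y : Site 3, R₀ ≤ Real.sqrt (∑ j, ((x) j : ℝ) ^ 2) → Real.sqrt (∑
      j, ((x - y) j : ℝ) ^ 2) ≤ δ * Real.sqrt (∑ j, ((x) j : ℝ) ^ 2) → |a x * Real.sqrt (∑ j, ((x) j : ℝ) ^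
      2) ^ (5 - η) - a y * Real.sqrt (∑ j, ((y) j : ℝ) ^ 2) ^ (5 - η)| ≤ ε) ∧ (∀ ε : ℝ, 0 < ε → ∃ K : ℝ, 0
      < K ∧ ∃ N₀ : ℕ, ∀ (i : Fin 3) (n : ℕ), N₀ ≤ n → (∑' y : Fin 2 → ℤ, if K * (n : ℝ) < ‖y‖ then a
      (Fin.insertNth i (n : ℤ) (y) : Site 3) else 0) ≤ ε * (∑' y : Fin 2 → ℤ, a (Fin.insertNth i (n : ℤ)
      (y) : Site 3)))) →
    (∀ f : (Fin 3 → ℝ) → ℝ, Continuous f → HasCompactSupport f → (0 : Fin 3 → ℝ) ∉ tsupport f → ∃ L : ℝ,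
      Filter.Tendsto (fun R : ℕ => (R : ℝ) ^ (2 - η) * ∑' x : Site 3, a x * f (fun j => (x j : ℝ) / (R :
      ℝ))) Filter.atTop (nhds L)) →
    (∃ (η : ℝ) (Φ : (Fin 3 → ℝ) → ℝ), 0 < η ∧ η < 1 ∧ ContinuousOn Φ {u | ∑ i, u i ^ 2 = 1} ∧ (∀ u : Fin 3
      → ℝ, ∑ i, u i ^ 2 = 1 → 0 ≤ Φ u) ∧ (∃ u : Fin 3 → ℝ, ∑ i, u i ^ 2 = 1 ∧ 0 < Φ u) ∧ Filter.Tendsto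
      (fun x : Site 3 => a x * Real.sqrt (∑ j, ((x) j : ℝ) ^ 2) ^ (5 - η) - Φ (fun i => (x i : ℝ) /
      Real.sqrt (∑ j, ((x) j : ℝ) ^ 2))) Filter.cofinite (nhds 0)) := by
  intro a η c ha hη0 hη1 hc hRad hReg hTMC
  obtain ⟨-, hR2, hR3⟩ := hReg
  -- the profile `h = a |·|₂^{5-η}`, the rounding lemma, and the pointwise limit `Φ u = lim h ⌊N u⌋`
  set h : Site 3 → ℝ := fun x => a x * √(∑ j, ((x j : ℝ)) ^ 2) ^ (5 - η) with hh_def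
  have hh : ∀ x, h x = a x * √(∑ j, ((x j : ℝ)) ^ 2) ^ (5 - η) := fun x => rfl
  have hG := approx_rounding h hR2
  set Φ : (Fin 3 → ℝ) → ℝ := fun u => limUnder atTop (fun N : ℕ => h (fun i => ⌊(N : ℝ) * u i⌋))
    with hΦ_def
  have hΦ : ∀ u : Fin 3 → ℝ, ∑ i, u i ^ 2 = 1 →
      Tendsto (fun N : ℕ => h (fun i => ⌊(N : ℝ) * u i⌋)) atTop (𝓝 (Φ u)) :=
    fun u hu => (cauchySeq_profile a η h hh hG hTMC u hu).tendsto_limUnder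
  have hcof := tendsto_profile_cofinite h Φ hG hΦ
  refine ⟨η, Φ, hη0, hη1, continuousOn_profileLimit h Φ hG hΦ,
    fun u hu => profileLimit_nonneg a η h hh ha Φ hΦ hu, ?_, hcof⟩
  -- non-degeneracy: if `Φ ≤ 0` on the sphere then `h → 0`, contradicting the radial asymptotics
  by_contra hneg
  push Not at hneg
  refine false_of_profile_small a η c h hh ha hη1 hc hRad hR3 fun ε hε => ?_
  refine exists_radius_of_eventually_cofinite ?_
  filter_upwards [Metric.tendsto_nhds.1 hcof ε hε,
    tendsto_sqrt_sum_sq_cofinite.eventually (eventually_ge_atTop 1)] with x hx hx1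
  have hpos : 0 < ∑ j, ((x j : ℝ)) ^ 2 := by
    by_contra hle
    push Not at hle
    have : √(∑ j, ((x j : ℝ)) ^ 2) = 0 := Real.sqrt_eq_zero'.2 hle
    rw [this] at hx1
    exact absurd hx1 (by norm_num)
  have hxS : ∑ i, ((x i : ℝ) / √(∑ j, ((x j : ℝ)) ^ 2)) ^ 2 = 1 := by
    simp only [div_pow]
    rw [← Finset.sum_div, Real.sq_sqrt hpos.le, div_self hpos.ne']
  have hΦ0 : Φ (fun i => (x i : ℝ) / √(∑ j, ((x j : ℝ)) ^ 2)) = 0 :=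
    le_antisymm (hneg _ hxS) (profileLimit_nonneg a η h hh ha Φ hΦ hxS)
  rw [hΦ0, sub_zero, dist_zero_right, Real.norm_eq_abs] at hx
  exact (le_abs_self _).trans hx.le

end Summit.CriticalPhenomena.Ising3DConformalLimit.Cruxes.DirectCorrelationStableTail.SelfEnergyPickInversion

end
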